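import Literature.MathematicalPhysics.QuantumFieldTheory.Balaban1983to89.B4RandomWalk213

/-!
# `BalabanImbrieJaffe1984to88.BIJ88WalkGeometryZd` — T. Bałaban, J. Imbrie, A. Jaffe, *Effective action and cluster
properties of the abelian Higgs model*, Commun. Math. Phys. **114** (1988) 257–315 [BalabanImbrieJaffe1988]:
Sect. 2 pp. 264–265, the LATTICE GEOMETRY entering (2.43)–(2.47) — `M`-cubes *"on a lattice of spacing M = O(1)"*,
`r(e_k)`-cubes, blocks, *"within ¼r(e_k) of x₁, x₂"*, *"|X| refers to the number of r(e_k)-cubes in X"* — realized on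
`ℤ^d`, and the geometric hypotheses of `BIJ88WalkGeometry246` (and of the siblings `BIJ88Ineq246Walks` / `BIJ88Ineq247Walks`)
DISCHARGED there: label distance one unit per step, touching cubes of degree `≤ 3^d`, non-touching cubes `≥ ℓ` labels
apart, Lipschitz site-to-label distance, `≤ (2t+1)^d` blocks per site.

statement-level skeleton of published theorems with citation tags; proofs where landed; nothing here is a claim about the Yang–Mills mass gap

PDF held: `paper:balaban1988-cmp114-bij-abelian-higgs-effective-action` (journal page = PDF page + 256).  Pages read as
images (poppler ×3 crops of PDF pp. 8–9 = journal 264–265).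

CITATION HEADER (lean-in-tree rule).  Part of the lit-balaban TYPED SKELETON (HOME `run/shared/lean/pub/lit-balaban/`),
Phase 2, seat p36 (gen 2, unit `lit-balaban-p36`); companion to `BIJ88WalkGeometry246` (p36) for rows C2.Eq2.46 / C2.Eq2.47:
the abstract geometric data there (`d`, `touch`, `cube`, far cubes, `ldist`, blocks) is INSTANTIATED on `ℤ^d` exactly as in
[6] = [Balaban1983RegularityDecay], §5 of `Balaban1983to89.B4RandomWalk213` (labels placed in `ℤ^d` by an injective `pos`,
adjacency `cubeAdj` = sup-distance `≤ 1`).  WHAT IS REPRODUCED, and how (every item PROVED, Mathlib-level lattice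
arithmetic; dictionary p. 264: `M`-cubes = labels, `r(e_k)`-cubes of `ℓ ≈ r(e_k)/M` labels a side, sites of the unit
lattice at `M′` sites per label unit, blocks = sites within `M′t` of a label):
* §1 `supDist` (sup-norm distance on `ℤ^d`, as a real number): zero diagonal, symmetry, triangle inequality, scaling
  bound; `supDist_le_one_of_cubeAdj` (one unit per step of a [6]-walk).
* §2 `cubeIdx ℓ` (the `r(e_k)`-cube of a label: coordinatewise Euclidean division by `ℓ`), the finite type `Cube pos ℓ` of
  cubes met by the labels with `cubeOf`, touching = `B4RandomWalk213.cubeAdj Subtype.val` (reflexive, symmetric, degree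
  `≤ 3^d` by `B4RandomWalk213.card_cubeAdj_le`), and **`le_supDist_of_not_touch`**: labels in non-touching cubes are
  `≥ ℓ` apart.
* §3 `ldistZ` (site-to-label distance `supDist x (M′·pos j)`): `M′`-Lipschitz along labels (`ldistZ_le`), site distance
  dominated through any label (`supDist_le_ldistZ`), **`exists_blocks`**: the labels within `M′t` of a site number
  `≤ (2t+1)^d`.
NOT here: the operators; the analytic hypotheses (majorant `Aβⁿ`, end-point locality, `Dβ ≤ e^{−δ}`, largeness of
`r(e_k)`), which stay hypotheses as in [6]; the corollaries for `C^{(k)}_{Λ,X}` / `C^{(k)}_{Λ,loc}` (sibling files).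
-/

namespace Literature.MathematicalPhysics.QuantumFieldTheory.BalabanImbrieJaffe1984to88.BIJ88WalkGeometryZd

open Finset
open Literature.MathematicalPhysics.QuantumFieldTheory.Balaban1983to89.B4RandomWalk213

variable {dd : ℕ}

/-! ## §1 The sup-norm distance on `ℤ^d` -/

/-- the sup-norm distance `max_μ |x_μ − y_μ|` on `ℤ^d`, as a real number ([6] (2.13): *"|j − j′| = max_μ|j_μ − j′_μ|"*;
used for the labels of the `M`-lattice and for the sites). [cite: BalabanImbrieJaffe1988, (2.42) p.264] -/
noncomputable def supDist (x y : Fin dd → ℤ) : ℝ :=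
  ((Finset.univ.sup fun μ => (x μ - y μ).natAbs : ℕ) : ℝ)

/-- coordinate bound: `|x_μ − y_μ| ≤ supDist x y`. [cite: BalabanImbrieJaffe1988, (2.42) p.264] -/
theorem natAbs_le_supDist (x y : Fin dd → ℤ) (μ : Fin dd) : ((x μ - y μ).natAbs : ℝ) ≤ supDist x y := by
  unfold supDist
  exact_mod_cast Finset.le_sup (f := fun μ => (x μ - y μ).natAbs) (Finset.mem_univ μ)

/-- `supDist x y ≤ n` iff every coordinate differs by at most `n`. [cite: BalabanImbrieJaffe1988, (2.42) p.264] -/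
theorem supDist_le_iff (x y : Fin dd → ℤ) (n : ℕ) : supDist x y ≤ n ↔ ∀ μ, (x μ - y μ).natAbs ≤ n := by
  unfold supDist
  rw [Nat.cast_le, Finset.sup_le_iff]
  simp

/-- nonnegativity. [cite: BalabanImbrieJaffe1988, (2.42) p.264] -/
theorem supDist_nonneg (x y : Fin dd → ℤ) : 0 ≤ supDist x y := by
  unfold supDist
  exact Nat.cast_nonneg _

/-- zero on the diagonal. [cite: BalabanImbrieJaffe1988, (2.42) p.264] -/
theorem supDist_self (x : Fin dd → ℤ) : supDist x x = 0 := by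
  unfold supDist
  simp

/-- symmetry. [cite: BalabanImbrieJaffe1988, (2.42) p.264] -/
theorem supDist_comm (x y : Fin dd → ℤ) : supDist x y = supDist y x := by
  unfold supDist
  congr 1
  exact Finset.sup_congr rfl fun μ _ => by rw [← Int.natAbs_neg, neg_sub]

/-- triangle inequality. [cite: BalabanImbrieJaffe1988, (2.42) p.264] -/
theorem supDist_triangle (x y z : Fin dd → ℤ) : supDist x z ≤ supDist x y + supDist y z := by
  have h : supDist x z ≤ (((Finset.univ.sup fun μ => (x μ - y μ).natAbs) +
      (Finset.univ.sup fun μ => (y μ - z μ).natAbs) : ℕ) : ℝ) := by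
    rw [supDist_le_iff]
    intro μ
    have h1 : (x μ - y μ).natAbs ≤ Finset.univ.sup fun μ => (x μ - y μ).natAbs :=
      Finset.le_sup (f := fun μ => (x μ - y μ).natAbs) (Finset.mem_univ μ)
    have h2 : (y μ - z μ).natAbs ≤ Finset.univ.sup fun μ => (y μ - z μ).natAbs :=
      Finset.le_sup (f := fun μ => (y μ - z μ).natAbs) (Finset.mem_univ μ)
    have h3 : (x μ - z μ).natAbs ≤ (x μ - y μ).natAbs + (y μ - z μ).natAbs := by
      have : x μ - z μ = (x μ - y μ) + (y μ - z μ) := by ring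
      rw [this]
      exact Int.natAbs_add_le _ _
    omega
  refine h.trans (le_of_eq ?_)
  unfold supDist
  push_cast
  rfl

/-- scaling bound: `supDist (m·x) (m·y) ≤ m · supDist x y` for `m : ℕ`. [cite: BalabanImbrieJaffe1988, (2.42) p.264] -/
theorem supDist_smul_le (m : ℕ) (x y : Fin dd → ℤ) :
    supDist (fun μ => (m : ℤ) * x μ) (fun μ => (m : ℤ) * y μ) ≤ m * supDist x y := by
  have h : supDist (fun μ => (m : ℤ) * x μ) (fun μ => (m : ℤ) * y μ) ≤
      ((m * Finset.univ.sup fun μ => (x μ - y μ).natAbs : ℕ) : ℝ) := by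
    rw [supDist_le_iff]
    intro μ
    rw [← mul_sub, Int.natAbs_mul, Int.natAbs_natCast]
    exact Nat.mul_le_mul_left m (Finset.le_sup (f := fun μ => (x μ - y μ).natAbs) (Finset.mem_univ μ))
  refine h.trans (le_of_eq ?_)
  unfold supDist
  push_cast
  rfl

/-- **ONE UNIT PER STEP**: adjacent labels of [6]'s walks (`cubeAdj`: *"|j − j′| = max_μ|j_μ − j′_μ| ≤ 1"*) are at
sup-distance `≤ 1` — the hypothesis `hadj` of `BIJ88WalkGeometry246.dist_ptAt_le`. [cite: BalabanImbrieJaffe1988, (2.42) p.264] -/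
theorem supDist_le_one_of_cubeAdj {ι : Type*} (pos : ι → Fin dd → ℤ) {i l : ι} (h : cubeAdj pos i l) :
    supDist (pos i) (pos l) ≤ 1 := by
  have h1 : supDist (pos i) (pos l) ≤ ((1 : ℕ) : ℝ) := by
    rw [supDist_le_iff]
    intro μ
    have hμ := h μ
    rw [Int.abs_eq_natAbs] at hμ
    exact_mod_cast hμ
  exact_mod_cast h1

/-! ## §2 The `r(e_k)`-cubes: cube index, touching, non-touching cubes are far -/

/-- the `r(e_k)`-CUBE of a label: coordinatewise Euclidean division by the side `ℓ` (`≈ r(e_k)/M` labels) — the map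
`M`-cube ↦ `r(e_k)`-cube behind *"X⁰ … the cubes of X"* met by a walk. [cite: BalabanImbrieJaffe1988, (2.44) p.264] -/
def cubeIdx (ℓ : ℕ) (x : Fin dd → ℤ) : Fin dd → ℤ := fun μ => x μ / (ℓ : ℤ)

/-- **CUBE ARITHMETIC**: if the cube indices of `a, b ∈ ℤ` (side `ℓ ≥ 1`) differ by at least `2`, then `|a − b| ≥ ℓ + 1`.
[cite: BalabanImbrieJaffe1988, (2.44) p.264] -/
theorem sub_ge_of_cubeIdx {ℓ : ℕ} (hℓ : 0 < ℓ) {a b : ℤ} (h : 2 ≤ a / (ℓ : ℤ) - b / (ℓ : ℤ)) :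
    (ℓ : ℤ) + 1 ≤ a - b := by
  have hℓ' : (0 : ℤ) < ℓ := by exact_mod_cast hℓ
  have ha : a % (ℓ : ℤ) = a - (ℓ : ℤ) * (a / (ℓ : ℤ)) := Int.emod_def a ℓ
  have hb : b % (ℓ : ℤ) = b - (ℓ : ℤ) * (b / (ℓ : ℤ)) := Int.emod_def b ℓ
  have hra : 0 ≤ a % (ℓ : ℤ) := Int.emod_nonneg a hℓ'.ne'
  have hrb : b % (ℓ : ℤ) < ℓ := Int.emod_lt_of_pos b hℓ'
  have hp : (ℓ : ℤ) * 2 ≤ (ℓ : ℤ) * (a / (ℓ : ℤ) - b / (ℓ : ℤ)) := mul_le_mul_of_nonneg_left h hℓ'.le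
  have hp' : (ℓ : ℤ) * (a / (ℓ : ℤ) - b / (ℓ : ℤ)) = (ℓ : ℤ) * (a / (ℓ : ℤ)) - (ℓ : ℤ) * (b / (ℓ : ℤ)) := mul_sub _ _ _
  linarith

/-- **NON-TOUCHING CUBES ARE FAR**: if the cubes (side `ℓ ≥ 1`) of two points of `ℤ^d` do not touch (some cube-index
coordinate differs by `≥ 2`), the points are at sup-distance `≥ ℓ` (indeed `≥ ℓ + 1`) — a walk of `M`-steps needs
`≥ ℓ ≈ r(e_k)/M` steps between them (hypothesis `hfar` of `BIJ88Ineq246Walks`). [cite: BalabanImbrieJaffe1988, (2.46) p.264] -/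
theorem le_supDist_of_not_touch {ℓ : ℕ} (hℓ : 0 < ℓ) (x y : Fin dd → ℤ)
    (h : ¬ ∀ μ, |cubeIdx ℓ x μ - cubeIdx ℓ y μ| ≤ 1) : (ℓ : ℝ) ≤ supDist x y := by
  push Not at h
  obtain ⟨μ, hμ⟩ := h
  unfold cubeIdx at hμ
  have h2 : 2 ≤ |x μ / (ℓ : ℤ) - y μ / (ℓ : ℤ)| := by omega
  have hcoord : (ℓ : ℤ) + 1 ≤ |x μ - y μ| := by
    rcases le_abs'.mp h2 with h2 | h2
    · have h' : 2 ≤ y μ / (ℓ : ℤ) - x μ / (ℓ : ℤ) := by linarith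
      have := sub_ge_of_cubeIdx hℓ h'
      rw [abs_sub_comm]
      exact this.trans (le_abs_self _)
    · exact (sub_ge_of_cubeIdx hℓ h2).trans (le_abs_self _)
  have h3 : ((ℓ : ℕ) : ℝ) ≤ ((x μ - y μ).natAbs : ℝ) := by
    have : (ℓ : ℤ) ≤ ((x μ - y μ).natAbs : ℤ) := by
      rw [← Int.abs_eq_natAbs]
      linarith
    exact_mod_cast this
  exact h3.trans (natAbs_le_supDist x y μ)

variable {ι : Type*} [Fintype ι]

/-- the finite type of `r(e_k)`-cubes met by the label set (cube indices of the labels). [cite: BalabanImbrieJaffe1988, (2.44) p.264] -/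
abbrev Cube (pos : ι → Fin dd → ℤ) (ℓ : ℕ) : Type := ↥(Finset.univ.image fun i => cubeIdx ℓ (pos i))

/-- the `r(e_k)`-cube of a label. [cite: BalabanImbrieJaffe1988, (2.44) p.264] -/
def cubeOf (pos : ι → Fin dd → ℤ) (ℓ : ℕ) (i : ι) : Cube pos ℓ :=
  ⟨cubeIdx ℓ (pos i), Finset.mem_image_of_mem _ (Finset.mem_univ i)⟩

/-- TOUCHING of cubes = cube indices at sup-distance `≤ 1` (`B4RandomWalk213.cubeAdj` on the indices): reflexive.
[cite: BalabanImbrieJaffe1988, (2.46) p.264] -/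
theorem touch_refl (pos : ι → Fin dd → ℤ) (ℓ : ℕ) (c : Cube pos ℓ) : cubeAdj Subtype.val c c :=
  fun μ => by simp

/-- touching is symmetric. [cite: BalabanImbrieJaffe1988, (2.46) p.264] -/
theorem touch_symm (pos : ι → Fin dd → ℤ) (ℓ : ℕ) (c c' : Cube pos ℓ) (h : cubeAdj Subtype.val c c') :
    cubeAdj Subtype.val c' c :=
  fun μ => by rw [abs_sub_comm]; exact h μ

/-- touching has degree `≤ 3^d` on any set of cubes (`B4RandomWalk213.card_cubeAdj_le`: *"at most … (3^d) …"*) — the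
hypotheses `hK`/`hKc` of `BIJ88Ineq246Walks` with `K = 3^d`. [cite: BalabanImbrieJaffe1988, (2.46) p.264] -/
theorem card_touch_le (pos : ι → Fin dd → ℤ) (ℓ : ℕ) (c : Cube pos ℓ) (Y : Finset (Cube pos ℓ)) :
    (Y.filter fun c' => cubeAdj Subtype.val c c').card ≤ 3 ^ dd :=
  (Finset.card_le_card (Finset.filter_subset_filter _ (Finset.subset_univ Y))).trans
    (card_cubeAdj_le Subtype.val Subtype.val_injective c)

/-- the closure neighbourhood `c = c′ ∨ cadj c c′` has degree `≤ 3^d` for any `cadj` contained in touching.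
[cite: BalabanImbrieJaffe1988, (2.46) p.264] -/
theorem card_closureNbhd_le (pos : ι → Fin dd → ℤ) (ℓ : ℕ) (cadj : Cube pos ℓ → Cube pos ℓ → Prop)
    [DecidableRel cadj] (hcadj : ∀ c c', cadj c c' → cubeAdj Subtype.val c c') (c : Cube pos ℓ) :
    (Finset.univ.filter fun c' => c = c' ∨ cadj c c').card ≤ 3 ^ dd := by
  refine (Finset.card_le_card fun c' hc' => ?_).trans (card_cubeAdj_le Subtype.val Subtype.val_injective c)
  rw [Finset.mem_filter] at hc' ⊢
  rcases hc'.2 with rfl | h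
  · exact ⟨Finset.mem_univ _, touch_refl pos ℓ c⟩
  · exact ⟨Finset.mem_univ _, hcadj _ _ h⟩

/-- **FAR CUBES ⇒ FAR LABELS** for the label geometry: labels whose cubes do not touch are at sup-distance `≥ ℓ`
(hypothesis `hfar` of `BIJ88Ineq246Walks` with `s = ℓ`). [cite: BalabanImbrieJaffe1988, (2.46) p.264] -/
theorem le_supDist_of_not_touch_cubeOf (pos : ι → Fin dd → ℤ) {ℓ : ℕ} (hℓ : 0 < ℓ) (i l : ι)
    (h : ¬ cubeAdj Subtype.val (cubeOf pos ℓ i) (cubeOf pos ℓ l)) : (ℓ : ℝ) ≤ supDist (pos i) (pos l) :=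
  le_supDist_of_not_touch hℓ (pos i) (pos l) h

/-! ## §3 Sites, site-to-label distance, blocks -/

omit [Fintype ι] in
/-- the SITE-TO-LABEL distance: sup-distance from the site `x ∈ ℤ^d` to the corner `M′·j` of the `M`-cube with label
`j` (`M′` sites per label unit) — the distance in *"ω remaining within ¼r(e_k) of x₁, x₂"*. [cite: BalabanImbrieJaffe1988, (2.43) p.264] -/
noncomputable def ldistZ (M' : ℕ) (pos : ι → Fin dd → ℤ) (j : ι) (x : Fin dd → ℤ) : ℝ :=
  supDist x fun μ => (M' : ℤ) * pos j μ

omit [Fintype ι] in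
/-- `ldistZ` is `M′`-Lipschitz along the labels (hypothesis `hld` of `BIJ88Ineq246Walks` with `μ = M′`).
[cite: BalabanImbrieJaffe1988, (2.43) p.264] -/
theorem ldistZ_le (M' : ℕ) (pos : ι → Fin dd → ℤ) (i l : ι) (x : Fin dd → ℤ) :
    ldistZ M' pos l x ≤ ldistZ M' pos i x + M' * supDist (pos i) (pos l) := by
  unfold ldistZ
  exact (supDist_triangle x (fun μ => (M' : ℤ) * pos i μ) fun μ => (M' : ℤ) * pos l μ).trans
    (add_le_add le_rfl (supDist_smul_le M' (pos i) (pos l)))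

omit [Fintype ι] in
/-- the site distance is dominated through any label: `|x₁ − x₂| ≤ ldistZ j x₁ + ldistZ j x₂` (hypothesis `hsd` of
`BIJ88Ineq247Walks`). [cite: BalabanImbrieJaffe1988, (2.47) p.265] -/
theorem supDist_le_ldistZ (M' : ℕ) (pos : ι → Fin dd → ℤ) (j : ι) (x₁ x₂ : Fin dd → ℤ) :
    supDist x₁ x₂ ≤ ldistZ M' pos j x₁ + ldistZ M' pos j x₂ := by
  unfold ldistZ
  rw [supDist_comm x₂]
  exact supDist_triangle _ _ _

/-- one-dimensional count: the integers `q` with `|x − M′q| ≤ M′t` lie in an interval of `2t + 1` integers.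
[cite: BalabanImbrieJaffe1988, (2.43) p.264] -/
theorem mem_Icc_of_natAbs_le {M' t : ℕ} (hM : 0 < M') {x q : ℤ} (h : (x - (M' : ℤ) * q).natAbs ≤ M' * t) :
    q ∈ Finset.Icc (x / (M' : ℤ) - t) (x / (M' : ℤ) + t) := by
  have hM' : (0 : ℤ) < M' := by exact_mod_cast hM
  have hx : x % (M' : ℤ) = x - (M' : ℤ) * (x / (M' : ℤ)) := Int.emod_def x M'
  have hr0 : 0 ≤ x % (M' : ℤ) := Int.emod_nonneg x hM'.ne'
  have hr1 : x % (M' : ℤ) < M' := Int.emod_lt_of_pos x hM'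
  have habs : |x - (M' : ℤ) * q| ≤ (M' : ℤ) * t := by
    rw [Int.abs_eq_natAbs]
    exact_mod_cast h
  rw [abs_le] at habs
  rw [Finset.mem_Icc]
  constructor
  · -- M′q ≥ x − M′t ≥ M′(x/M′) + 0 − M′t ⇒ q ≥ x/M′ − t
    by_contra hq
    push Not at hq
    have hq' : q + 1 ≤ x / (M' : ℤ) - t := by omega
    have := mul_le_mul_of_nonneg_left hq' hM'.le
    nlinarith
  · by_contra hq
    push Not at hq
    have hq' : x / (M' : ℤ) + t + 1 ≤ q := by omega
    have := mul_le_mul_of_nonneg_left hq' hM'.le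
    nlinarith

/-- **BLOCKS PER SITE**: with injective labels, at most `(2t+1)^d` labels `j` lie within site-distance `M′t` of a given
site (blocks = enlarged `M`-cubes; hypothesis `hS₀` of `BIJ88Ineq246Walks` with `s₀ = (2t+1)^d`, `b₀ = M′t`).
[cite: BalabanImbrieJaffe1988, (2.43) p.264] -/
theorem exists_blocks {M' : ℕ} (hM : 0 < M') (t : ℕ) (pos : ι → Fin dd → ℤ) (hpos : Function.Injective pos)
    (x : Fin dd → ℤ) :
    ∃ S₀ : Finset ι, S₀.card ≤ (2 * t + 1) ^ dd ∧ ∀ j, ldistZ M' pos j x ≤ M' * t → j ∈ S₀ := by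
  classical
  set S₀ : Finset ι := Finset.univ.filter fun j => ldistZ M' pos j x ≤ M' * t with hS₀
  refine ⟨S₀, ?_, fun j hj => Finset.mem_filter.mpr ⟨Finset.mem_univ _, hj⟩⟩
  set T : Finset (Fin dd → ℤ) :=
    Fintype.piFinset fun μ : Fin dd => Finset.Icc (x μ / (M' : ℤ) - t) (x μ / (M' : ℤ) + t) with hT
  have h1 : (S₀.image pos).card = S₀.card := Finset.card_image_of_injective S₀ hpos
  have h2 : S₀.image pos ⊆ T := by
    intro z hz
    obtain ⟨j, hj, rfl⟩ := Finset.mem_image.mp hz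
    have hj' : ldistZ M' pos j x ≤ M' * t := (Finset.mem_filter.mp hj).2
    rw [hT, Fintype.mem_piFinset]
    intro μ
    refine mem_Icc_of_natAbs_le hM ?_
    have hμ : ((x μ - (M' : ℤ) * pos j μ).natAbs : ℝ) ≤ M' * t :=
      (natAbs_le_supDist x (fun μ => (M' : ℤ) * pos j μ) μ).trans hj'
    exact_mod_cast hμ
  have h3 : T.card = (2 * t + 1) ^ dd := by
    rw [hT, Fintype.card_piFinset]
    rw [Finset.prod_congr rfl fun μ _ => by
      rw [Int.card_Icc, show x μ / (M' : ℤ) + t + 1 - (x μ / (M' : ℤ) - t) = ((2 * t + 1 : ℕ) : ℤ) by push_cast; ring,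
        Int.toNat_natCast]]
    simp
  rw [← h1, ← h3]
  exact Finset.card_le_card h2

end Literature.MathematicalPhysics.QuantumFieldTheory.BalabanImbrieJaffe1984to88.BIJ88WalkGeometryZd
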